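import Literature.NumberTheory.GaloisRepresentations.LubinTateColeman
import Mathlib.RingTheory.PowerSeries.Derivative
import HarnessLib

/-!
# The derivative of a topological evaluation `h(t)` of a power series and of the Coleman translates
`h(X [+] ω)`

De Shalit, *Iwasawa theory of elliptic curves with complex multiplication* (1987), Ch. I §3.5 / §3.12:
the Coates–Wiles homomorphisms and the comparison `δ : {𝒩g = g} → {𝒮h = h}` (`δg = (1/λ') g'/g`) are
obtained by DIFFERENTIATING the identity `(𝒩g) ∘ f = ∏_{ω} g(X [+] ω)`, in which the translates
`g(X [+] ω) ∈ 𝒪_L⟦X⟧` are TOPOLOGICAL evaluations (`LubinTate.transl`, `LubinTate.evalAt` at the point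
`X [+] ω` of `𝒪_L⟦X⟧`; the constant term `ω ∈ 𝔪_L` is not nilpotent, so Mathlib's algebraic `subst` and
its chain rule `PowerSeries.derivative_subst` do not apply). This file proves the needed chain rule
(everything **proved**):

* ★ `PowerSeries.derivative_aeval` — for a complete Hausdorff linearly topologised `A`-algebra `S`
  and a topologically nilpotent `t ∈ S⟦X⟧`: **`d⁄dX (h(t)) = h'(t) · t'`** for every `h ∈ A⟦X⟧`
  (termwise differentiation of `h(t) = Σ hₙ tⁿ`, `Derivation.leibniz_pow`, and re-indexing).
* `LubinTate.derivative_evalAt` / ★ `LubinTate.derivative_transl` —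
  **`d⁄dX h(X [+] ω) = h'(X [+] ω) · d⁄dX (X [+] ω)`**.

## References

* E. de Shalit, *Iwasawa theory of elliptic curves with complex multiplication* (1987), Ch. I §3.5
  (the invariant derivation `D`, Coates–Wiles homomorphisms), §3.12. [cite: deShalit1987, Ch. I §3.5]

## Mathlib reuse

`PowerSeries.hasSum_aeval`, `PowerSeries.derivative` (`d⁄dX`, a `Derivation`), `Derivation.leibniz_pow`,
`PowerSeries.coeff_derivative`, `HasSum.map`, `hasSum_nat_add_iff'`, `HasSum.unique`, `continuous_pi`;
from the tree: `LubinTateColeman.lean` (`evalAt`, `transl`, `tPt`, `seriesNilIdeal`).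
-/

noncomputable section

open Filter Topology
open scoped PowerSeries.WithPiTopology

/-! ### The chain rule for topological evaluation -/

namespace PowerSeries

variable {A : Type*} [CommRing A] [UniformSpace A] [DiscreteUniformity A]
variable {S : Type*} [CommRing S] [UniformSpace S] [IsUniformAddGroup S] [IsTopologicalRing S]
  [IsLinearTopology S S] [T2Space S] [CompleteSpace S] [Algebra A S] [ContinuousSMul A S]

omit [UniformSpace A] [DiscreteUniformity A] [IsUniformAddGroup S]
  [IsLinearTopology S S] [T2Space S] [CompleteSpace S] [Algebra A S] [ContinuousSMul A S] in
/-- The formal derivative is continuous for the product topology (its coefficients are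
`(n+1) · (coefficient n+1)`). [cite: deShalit1987, Ch. I §3.5] -/
theorem continuous_derivative : Continuous (derivative S : S⟦X⟧ → S⟦X⟧) := by
  refine continuous_pi fun d => ?_
  have hd : d = Finsupp.single () (d ()) := Finsupp.unique_single d
  have e : (fun G : S⟦X⟧ => (derivative S G) d) =
      fun G => coeff (d () + 1) G * ((d () : S) + 1) := by
    funext G
    have e1 : (derivative S G) d = coeff (d ()) (derivative S G) := by
      change MvPowerSeries.coeff d (derivative S G) = _
      conv_lhs => rw [hd]
      rfl
    rw [e1, coeff_derivative]
  rw [e]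
  exact (MvPowerSeries.WithPiTopology.continuous_coeff S (Finsupp.single () (d () + 1))).mul
    continuous_const

omit [UniformSpace A] [DiscreteUniformity A] [UniformSpace S] [IsUniformAddGroup S] [IsTopologicalRing S]
  [IsLinearTopology S S] [T2Space S] [CompleteSpace S] [ContinuousSMul A S] in
/-- `a • G = C(a) · G` for the `A`-action on `S⟦X⟧`. [cite: deShalit1987, Ch. I §3.5] -/
theorem algebra_smul_eq_C_mul (a : A) (G : S⟦X⟧) : a • G = C (algebraMap A S a) * G := by
  rw [Algebra.smul_def, IsScalarTower.algebraMap_apply A S S⟦X⟧, ← C_eq_algebraMap]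

/-- ★ **Chain rule for topological evaluation**: for `t ∈ S⟦X⟧` topologically nilpotent and
`h ∈ A⟦X⟧`, `d⁄dX (h(t)) = h'(t) · t'` (termwise: `d⁄dX Σ hₙ tⁿ = Σ hₙ n tⁿ⁻¹ t'`).
[cite: deShalit1987, Ch. I §3.5] -/
theorem derivative_aeval {t : S⟦X⟧} (ht : IsTopologicallyNilpotent t) (h : A⟦X⟧) :
    derivative S (aeval ht h) = aeval ht (derivative A h) * derivative S t := by
  -- `h(t) = Σ hₙ • tⁿ`, apply the continuous additive map `d⁄dX`
  have h1 : HasSum (fun n => derivative S (coeff n h • t ^ n)) (derivative S (aeval ht h)) :=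
    (hasSum_aeval ht h).map (derivative S).toLinearMap.toAddMonoidHom continuous_derivative
  -- `h'(t) · t' = Σ ((n+1) h_{n+1}) • tⁿ · t'`
  have h2 : HasSum (fun n => (coeff n (derivative A h) • t ^ n) * derivative S t)
      (aeval ht (derivative A h) * derivative S t) :=
    (hasSum_aeval ht (derivative A h)).mul_right _
  -- the two families agree after the shift `n ↦ n + 1`
  have h3 : (fun n => derivative S (coeff (n + 1) h • t ^ (n + 1))) =
      fun n => (coeff n (derivative A h) • t ^ n) * derivative S t := by
    funext n
    rw [algebra_smul_eq_C_mul, algebra_smul_eq_C_mul, (derivative S).leibniz, derivative_C, smul_zero,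
      add_zero, (derivative S).leibniz_pow, Nat.add_sub_cancel, coeff_derivative, map_mul, map_add, map_one,
      map_natCast, map_mul, map_add, map_natCast, map_one, smul_eq_mul, nsmul_eq_mul, smul_eq_mul]
    push_cast
    ring
  have h0 : derivative S (coeff 0 h • t ^ 0) = 0 := by
    rw [pow_zero, algebra_smul_eq_C_mul, mul_one, derivative_C]
  have h4 := (hasSum_nat_add_iff' 1).mpr h1
  rw [Finset.sum_range_one, h0, sub_zero, h3] at h4
  exact h4.unique h2

end PowerSeries

/-! ### Derivatives of the Coleman translates -/

namespace Literature.NumberTheory.GaloisRepresentations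

namespace LubinTate

variable {A : Type*} [CommRing A] [UniformSpace A] [DiscreteUniformity A]
variable {S : Type*} [CommRing S] [UniformSpace S] [IsUniformAddGroup S] [IsTopologicalRing S]
  [IsLinearTopology S S] [T2Space S] [CompleteSpace S] [Algebra A S] [ContinuousSMul A S]
variable (M : NilIdeal S)

/-- **`d⁄dX h(u) = h'(u) · u'`** for the evaluation of `h ∈ A⟦X⟧` at a point `u` of `S⟦X⟧` (constant
term in `M`). [cite: deShalit1987, Ch. I §3.5] -/
theorem derivative_evalAt (u : (seriesNilIdeal M).toIdeal) (h : PowerSeries A) :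
    PowerSeries.derivative S (evalAt (seriesNilIdeal M) u h) =
      evalAt (seriesNilIdeal M) u (PowerSeries.derivative A h) *
        PowerSeries.derivative S (u : PowerSeries S) := by
  rw [evalAt_apply, evalAt_apply]
  exact PowerSeries.derivative_aeval _ h

variable {π : A} {q : ℕ} (hA : IsLTRing π q) {f : PowerSeries A} (hf : IsLTSeries π q f)

/-- ★ **`d⁄dX h(X [+] ω) = h'(X [+] ω) · d⁄dX (X [+] ω)`** — the derivative of a Coleman translate.
[cite: deShalit1987, Ch. I §3.5] -/
theorem derivative_transl (ω : M.toIdeal) (h : PowerSeries A) :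
    PowerSeries.derivative S (transl M hA hf ω h) =
      transl M hA hf ω (PowerSeries.derivative A h) *
        PowerSeries.derivative S ((tPt M hA hf ω : (seriesNilIdeal M).toIdeal) : PowerSeries S) := by
  rw [transl, transl]
  exact derivative_evalAt M _ h

end LubinTate

end Literature.NumberTheory.GaloisRepresentations
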